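import Summits.NavierStokesRegularity.NavierStokesRegularity.Theses.PalasekTowerBreakdown
import Summits.NavierStokesRegularity.FluidComputer.PalasekTowerRegisterGlobalExactSliceEpisode
import Summits.NavierStokesRegularity.FluidComputer.PalasekTowerGermHostExplicit

/-!
# NavierStokesRegularity — route `PalasekTowerBreakdown`, crux `EpisodeBase`: the EXPLICIT exact-slice doors,
# plain and `∃`-packaged (the stub shape of record for the line `slot`, refuter4 K94)

Supports `stmt-NavierStokesRegularity-19179` (`PalasekTowerBreakdown.EpisodeBase` = K1G `EpisodeBaseG`; helper, closes
nothing). Cell `ns-blowup`, seat `ns-blowup-ecbridge-4` (g5; stub `first_episode`). Sequel of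
`PalasekTowerBreakdownEpisodeBaseSlice.lean` (p470149: `…_episodeBase_of_lineGerm_sliceRun`, the slice-run feeders of the
registered v4 stub). refuter4 K94 (STATUS 22:30Z): the v4 stub's feeders evaluate at the OPAQUE `h.width / h.fadeLen`
(`Classical.choose`) of `Germ.LevelZeroData`, so no certified integration can target them except uniformly; the
certificate-ready door is the EXPLICIT one over `Germ.LineGermData U ρ σ₀ ε c₄` (every parameter named). This file gives
that door in the three further shapes a line / a numerics seat consumes, proved from the FluidComputer register theorems only
(`firstEpisodeD_exact_of_sliceRun`, `episodeBaseG_of_exact`, `Germ.LineGermData.*`; no Theorems import):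

* `palasekTowerBreakdown_episodeBase_of_lineGerm_pushedRun` — explicit design `d : LineGermData U ρ σ₀ ε c₄`, push
  constant `c ≤ 1`, admissible re-push `g` (Clay class, `= lineForce U σ₀ ε` on `[0, 1]`, `‖g‖ ≤ c Y₀` on
  `[1, Host.τfirst]`, zero from `Host.τfirst` on, confined to `B̄(0, ρ)`; the later-window bounds and silence from `T`
  are then automatic), ONE classical finite-energy run of Navier–Stokes (`ν = 1`) under `g` on `[1, Host.τfirst]` with
  `v 1 = U`, below `(5/3) Y₁`, with the level-`1` letter at `Host.τfirst` in `B̄(0, ρ)` ⟹ `EpisodeBase`;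
  (the plain door under the design's OWN force is the landed `palasekTowerBreakdown_episodeBase_of_lineGerm_sliceRun`);
* `palasekTowerBreakdown_episodeBase_of_exists_lineGerm_selfRun` / `…_of_exists_lineGerm_pushedRun` — the two doors
  `∃`-PACKAGED over `(U, ρ, σ₀, ε, c₄, d, [c, g,] v, q)`: a skeleton registering either `∃` as its one stub composes with
  the matching theorem as `EpisodeBase_of` (K94's recommendation to the holder `ns-palasek-19179-p2`).

LABEL: E–C typing (pure glue, by name). WHAT THIS IS NOT: not NS — implications whose hypothesis is ONE classical forced
Navier–Stokes run on the first growth window with the level-`1` readouts; nothing asserted about whether one exists.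

References: S. Palasek, arXiv:2605.13827 §4 [cite: Palasek2026ElementaryModel, §4]; H. Sohr, *The Navier–Stokes
Equations* (2001), Ch. V Thm. 1.5.1 [cite: Sohr2001, Ch. V Thm. 1.5.1].
-/

noncomputable section

-- `Summit.<Summit>.<Problem>` is the tree's mandated summit-side namespace (CONVENTIONS §2); for this
-- single-conjunct summit the two coincide, so the duplicate is deliberate.
set_option linter.dupNamespace false

namespace Summit.NavierStokesRegularity.NavierStokesRegularity.Theorems

open Set Function MeasureTheory
open scoped ENNReal
open Summit.NavierStokesRegularity.NavierStokesRegularity.Theses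
open Summit.NavierStokesRegularity.FluidComputer.PalasekTowerClayBridge
open Summit.NavierStokesRegularity.FluidComputer.PalasekTowerClayBridge.Germ
open Literature.Analysis.FluidPDE

variable {U : EuclideanSpace ℝ (Fin 3) → EuclideanSpace ℝ (Fin 3)} {ρ σ₀ ε c₄ : ℝ}

/-- **`EpisodeBase` from ONE PUSHED RUN STARTING AT THE PROFILE `U` OF AN EXPLICIT GERM DESIGN** (every
parameter explicit): a push constant `c ≤ 1`, an admissible re-push `g` (Clay class, `= lineForce U σ₀ ε` on
`[0, 1]`, `‖g‖ ≤ c Y₀` on `[1, Host.τfirst]`, zero from `Host.τfirst` on, confined to `B̄(0, ρ)`) and ONE classical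
finite-energy solution of Navier–Stokes at unit viscosity forced by `g` on `[1, Host.τfirst]` with `v 1 = U`, below
`(5/3) Y₁`, with the level-`1` letter at `Host.τfirst` in `B̄(0, ρ)` ⟹ `EpisodeBase`. The host's slice at `τ₀ = 1`
is `U` (`Stage.velocity_eq_of_classical` against the closed-form line germ), the run from the slice closes
`FirstEpisodeD (exact d.schedule)` (`firstEpisodeD_exact_of_sliceRun`), and the split glues (`episodeBaseG_of_exact`).
[cite: Palasek2026ElementaryModel, §4] [cite: Sohr2001, Ch. V Thm. 1.5.1] -/
theorem palasekTowerBreakdown_episodeBase_of_lineGerm_pushedRun (d : LineGermData U ρ σ₀ ε c₄)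
    {c : ℝ} (hc : c ≤ 1) {g : ℝ → EuclideanSpace ℝ (Fin 3) → EuclideanSpace ℝ (Fin 3)}
    (h₁ : IsSmoothOnHalfSpace g) (h₂ : HasRapidSpaceTimeDecay g)
    (hg : ∀ t ∈ Icc (0 : ℝ) 1, ∀ x, g t x = lineForce U σ₀ ε t x)
    (hwin : ∀ t ∈ Icc (1 : ℝ) Host.τfirst, ∀ x, ‖g t x‖ ≤ c * TowerRates.wide.Y 0)
    (hsilent : ∀ t, Host.τfirst ≤ t → g t = 0) (hconf : ∀ t x, ρ < ‖x‖ → g t x = 0)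
    {v : ℝ → EuclideanSpace ℝ (Fin 3) → EuclideanSpace ℝ (Fin 3)}
    {q : ℝ → EuclideanSpace ℝ (Fin 3) → ℝ}
    (hcl : IsClassicalNSSolutionOn (Icc 1 Host.τfirst) 1 g v q) (h1 : v 1 = U)
    (henergy : ∃ C : ℝ≥0∞, C < ⊤ ∧ ∀ t ∈ Icc (1 : ℝ) Host.τfirst, ∫⁻ x, ‖v t x‖ₑ ^ 2 ≤ C)
    (hceil : ∀ t ∈ Icc (1 : ℝ) Host.τfirst, ∀ x, ‖v t x‖ ≤ 5 / 3 * TowerRates.wide.Y 1)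
    (hfloor : ∃ x, ‖x‖ ≤ ρ ∧ TowerRates.wide.Y 1 ≤ ‖v Host.τfirst x‖)
    (hstrain : ∃ x, ‖x‖ ≤ ρ ∧ TowerRates.wide.A 1 ≤ ‖fderiv ℝ (v Host.τfirst) x‖)
    (hcore : ∃ (x : EuclideanSpace ℝ (Fin 3)) (γ : ℝ → EuclideanSpace ℝ (Fin 3)),
      ‖x‖ ≤ ρ ∧ ContDiff ℝ 1 γ ∧ γ 0 = γ 1 ∧
      (∀ s ∈ Icc (0 : ℝ) 1, γ s ∈ Metric.closedBall x (1 / TowerRates.wide.N 1)) ∧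
      (∀ s ∈ Icc (0 : ℝ) 1, ‖deriv γ s‖ ≤ 8 * Real.pi / TowerRates.wide.N 1) ∧
      TowerRates.wide.N 1 ^ (TowerRates.wide.β - 2) ≤ circulation (v Host.τfirst) γ) :
    PalasekTowerBreakdown.EpisodeBase := by
  obtain ⟨s₀⟩ := d.stage
  have hτ0 : d.schedule.τ 0 = 1 := d.schedule_τ_zero
  have hτ1 : d.schedule.τ 1 = Host.τfirst := d.schedule_τ_one
  have hY0 : 0 < TowerRates.wide.Y 0 := Real.rpow_pos_of_pos (TowerRates.wide.N_pos 0) _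
  -- the host's slice at `τ₀ = 1` is the profile `U` (the stage pins the design's flow: forced Serrin–Masuda)
  have hslice : s₀.u 1 = U := by
    have h0 : lineVel U σ₀ 0 = d.schedule.u₀ := by rw [lineVel_zero]; rfl
    have key := s₀.velocity_eq_of_classical one_pos (T' := 1) (by rw [hτ0]) d.isClassicalNSSolutionOn_vel
      h0 d.energy_vel
    rw [hτ0] at key
    rw [← key 1 ⟨zero_le_one, le_rfl⟩, lineVel_one]
  -- `0 ≤ c` (the push bound at `t = 1`), so the later windows and the silence from `T` are free
  have hw01 : (1 : ℝ) ≤ Host.τfirst := by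
    rw [← hτ1, ← hτ0]; exact (d.schedule.τ_lt_succ 0).le
  have hc0 : 0 ≤ c := by
    have h := hwin 1 ⟨le_rfl, hw01⟩ 0
    nlinarith [norm_nonneg (g 1 0)]
  have hzero : ∀ t, Host.τfirst ≤ t → ∀ x, g t x = 0 := fun t ht x => by rw [hsilent t ht]; rfl
  have h₃ : ∀ t, d.schedule.T ≤ t → ∀ x, g t x = 0 := fun t ht x =>
    hzero t ((hτ1 ▸ (d.schedule.τ_lt_T 1).le).trans ht) x
  have h₄ : ∀ k, ∀ t ∈ Icc (d.schedule.τ k) (d.schedule.τ (k + 1)), ∀ x,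
      ‖g t x‖ ≤ c * TowerRates.wide.Y k := by
    intro k t ht x
    rcases Nat.eq_zero_or_pos k with rfl | hk
    · rw [hτ0] at ht
      exact hwin t ⟨ht.1, by rw [← hτ1]; exact ht.2⟩ x
    · have hge : Host.τfirst ≤ t := by rw [← hτ1]; exact (d.schedule.τ_mono hk).trans ht.1
      rw [hzero t hge x, norm_zero]
      exact mul_nonneg hc0 (Real.rpow_pos_of_pos (TowerRates.wide.N_pos k) _).le
  have hc' : c ≤ d.schedule.c₁ := by rw [d.schedule_c₁]; exact hc
  have hF : FirstEpisodeD (HostClass.exact d.schedule) := by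
    refine firstEpisodeD_exact_of_sliceRun d.schedule_pins d.schedule_rigid s₀ hc' h₁ h₂ h₃ h₄ ?_ ?_ ?_
      (v := v) (q := q) ?_ ?_ ?_ ?_ ?_
    · show ∀ t ∈ Icc 0 (d.schedule.τ 0), ∀ x, g t x = d.schedule.f t x
      rw [hτ0, d.schedule_f]; exact hg
    · show ∀ t, d.schedule.τ 1 ≤ t → g t = 0
      rw [hτ1]; exact hsilent
    · show ∀ t x, d.schedule.radius < ‖x‖ → g t x = 0
      rw [d.schedule_radius]; exact hconf
    · show IsClassicalNSSolutionOn (Icc (d.schedule.τ 0) (d.schedule.τ 1)) 1 g v q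
      rw [hτ0, hτ1]; exact hcl
    · show v (d.schedule.τ 0) = s₀.u (d.schedule.τ 0)
      rw [hτ0, h1, hslice]
    · show ∃ C : ℝ≥0∞, C < ⊤ ∧ ∀ t ∈ Icc (d.schedule.τ 0) (d.schedule.τ 1), ∫⁻ x, ‖v t x‖ₑ ^ 2 ≤ C
      rw [hτ0, hτ1]; exact henergy
    · show ∀ t ∈ Icc (d.schedule.τ 0) (d.schedule.τ 1), ∀ x, ‖v t x‖ ≤ d.schedule.c₂ * TowerRates.wide.Y 1
      rw [hτ0, hτ1, d.schedule_c₂]; exact hceil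
    · show (∃ x, ‖x‖ ≤ d.schedule.radius ∧
          d.schedule.c₁ * TowerRates.wide.Y 1 ≤ ‖v (d.schedule.τ 1) x‖) ∧
        (∃ x, ‖x‖ ≤ d.schedule.radius ∧
          d.schedule.c₁ * TowerRates.wide.A 1 ≤ ‖fderiv ℝ (v (d.schedule.τ 1)) x‖) ∧
        (∃ (x : EuclideanSpace ℝ (Fin 3)) (γ : ℝ → EuclideanSpace ℝ (Fin 3)),
          ‖x‖ ≤ d.schedule.radius ∧ ContDiff ℝ 1 γ ∧ γ 0 = γ 1 ∧
          (∀ s ∈ Icc (0 : ℝ) 1, γ s ∈ Metric.closedBall x (1 / TowerRates.wide.N 1)) ∧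
          (∀ s ∈ Icc (0 : ℝ) 1, ‖deriv γ s‖ ≤ 8 * Real.pi / TowerRates.wide.N 1) ∧
          d.schedule.c₁ * TowerRates.wide.N 1 ^ (TowerRates.wide.β - 2) ≤
            circulation (v (d.schedule.τ 1)) γ)
      rw [hτ1, d.schedule_radius, d.schedule_c₁, one_mul, one_mul, one_mul]
      exact ⟨hfloor, hstrain, hcore⟩
  unfold PalasekTowerBreakdown.EpisodeBase
  exact d.episodeBaseG_of_firstEpisodeD hF

/-- **∃-PACKAGED EXPLICIT DOOR (design's own force)** — the stub shape refuter4 K94 recommends for the line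
`slot`: SOME explicit germ design `(U, ρ, σ₀, ε, c₄)` with `Germ.LineGermData U ρ σ₀ ε c₄` and SOME classical
finite-energy run of Navier–Stokes at unit viscosity on `[1, Host.τfirst]` under `lineForce U σ₀ ε` STARTING FROM `U`,
below `(5/3) Y₁`, with the level-`1` letter at `Host.τfirst` in `B̄(0, ρ)` ⟹ `EpisodeBase`. A skeleton registering
this `∃` as its stub composes with this theorem as `EpisodeBase_of`. [cite: Palasek2026ElementaryModel, §4] -/
theorem palasekTowerBreakdown_episodeBase_of_exists_lineGerm_selfRun
    (hex : ∃ (U : EuclideanSpace ℝ (Fin 3) → EuclideanSpace ℝ (Fin 3)) (ρ σ₀ ε c₄ : ℝ)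
      (_ : LineGermData U ρ σ₀ ε c₄)
      (v : ℝ → EuclideanSpace ℝ (Fin 3) → EuclideanSpace ℝ (Fin 3)) (q : ℝ → EuclideanSpace ℝ (Fin 3) → ℝ),
      IsClassicalNSSolutionOn (Icc 1 Host.τfirst) 1 (lineForce U σ₀ ε) v q ∧ v 1 = U ∧
      (∃ C : ℝ≥0∞, C < ⊤ ∧ ∀ t ∈ Icc (1 : ℝ) Host.τfirst, ∫⁻ x, ‖v t x‖ₑ ^ 2 ≤ C) ∧
      (∀ t ∈ Icc (1 : ℝ) Host.τfirst, ∀ x, ‖v t x‖ ≤ 5 / 3 * TowerRates.wide.Y 1) ∧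
      (∃ x, ‖x‖ ≤ ρ ∧ TowerRates.wide.Y 1 ≤ ‖v Host.τfirst x‖) ∧
      (∃ x, ‖x‖ ≤ ρ ∧ TowerRates.wide.A 1 ≤ ‖fderiv ℝ (v Host.τfirst) x‖) ∧
      (∃ (x : EuclideanSpace ℝ (Fin 3)) (γ : ℝ → EuclideanSpace ℝ (Fin 3)),
        ‖x‖ ≤ ρ ∧ ContDiff ℝ 1 γ ∧ γ 0 = γ 1 ∧
        (∀ s ∈ Icc (0 : ℝ) 1, γ s ∈ Metric.closedBall x (1 / TowerRates.wide.N 1)) ∧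
        (∀ s ∈ Icc (0 : ℝ) 1, ‖deriv γ s‖ ≤ 8 * Real.pi / TowerRates.wide.N 1) ∧
        TowerRates.wide.N 1 ^ (TowerRates.wide.β - 2) ≤ circulation (v Host.τfirst) γ)) :
    PalasekTowerBreakdown.EpisodeBase := by
  obtain ⟨U, ρ, σ₀, ε, c₄, d, v, q, hcl, h1, henergy, hceil, hfloor, hstrain, hcore⟩ := hex
  -- push = the design's own force `lineForce U σ₀ ε`, constant `c₄ ≤ 1` (the landed plain form of this door is
  -- `palasekTowerBreakdown_episodeBase_of_lineGerm_sliceRun`, `PalasekTowerBreakdownEpisodeBaseSlice.lean`)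
  exact palasekTowerBreakdown_episodeBase_of_lineGerm_pushedRun d d.push_le d.schedule.force_smooth
    d.schedule.force_decay (fun _ _ _ => rfl) d.norm_force_le
    (fun t ht => funext fun x => d.force_eq_zero_of_ge t ht x) (fun t x hx => d.force_eq_zero_of_norm_gt t x hx)
    hcl h1 henergy hceil hfloor hstrain hcore

/-- **∃-PACKAGED EXPLICIT DOOR (pushed)**: SOME explicit germ design, SOME push constant `c ≤ 1` and admissible
re-push `g` (Clay class, `= lineForce U σ₀ ε` on `[0, 1]`, `‖g‖ ≤ c Y₀` on `[1, Host.τfirst]`, zero from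
`Host.τfirst` on, confined to `B̄(0, ρ)`), and SOME classical finite-energy run under `g` on `[1, Host.τfirst]` from `U`,
below `(5/3) Y₁`, with the level-`1` letter ⟹ `EpisodeBase`. [cite: Palasek2026ElementaryModel, §4] -/
theorem palasekTowerBreakdown_episodeBase_of_exists_lineGerm_pushedRun
    (hex : ∃ (U : EuclideanSpace ℝ (Fin 3) → EuclideanSpace ℝ (Fin 3)) (ρ σ₀ ε c₄ : ℝ)
      (_ : LineGermData U ρ σ₀ ε c₄) (c : ℝ) (_ : c ≤ 1)
      (g : ℝ → EuclideanSpace ℝ (Fin 3) → EuclideanSpace ℝ (Fin 3)),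
      IsSmoothOnHalfSpace g ∧ HasRapidSpaceTimeDecay g ∧
      (∀ t ∈ Icc (0 : ℝ) 1, ∀ x, g t x = lineForce U σ₀ ε t x) ∧
      (∀ t ∈ Icc (1 : ℝ) Host.τfirst, ∀ x, ‖g t x‖ ≤ c * TowerRates.wide.Y 0) ∧
      (∀ t, Host.τfirst ≤ t → g t = 0) ∧ (∀ t x, ρ < ‖x‖ → g t x = 0) ∧
      ∃ (v : ℝ → EuclideanSpace ℝ (Fin 3) → EuclideanSpace ℝ (Fin 3)) (q : ℝ → EuclideanSpace ℝ (Fin 3) → ℝ),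
        IsClassicalNSSolutionOn (Icc 1 Host.τfirst) 1 g v q ∧ v 1 = U ∧
        (∃ C : ℝ≥0∞, C < ⊤ ∧ ∀ t ∈ Icc (1 : ℝ) Host.τfirst, ∫⁻ x, ‖v t x‖ₑ ^ 2 ≤ C) ∧
        (∀ t ∈ Icc (1 : ℝ) Host.τfirst, ∀ x, ‖v t x‖ ≤ 5 / 3 * TowerRates.wide.Y 1) ∧
        (∃ x, ‖x‖ ≤ ρ ∧ TowerRates.wide.Y 1 ≤ ‖v Host.τfirst x‖) ∧
        (∃ x, ‖x‖ ≤ ρ ∧ TowerRates.wide.A 1 ≤ ‖fderiv ℝ (v Host.τfirst) x‖) ∧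
        (∃ (x : EuclideanSpace ℝ (Fin 3)) (γ : ℝ → EuclideanSpace ℝ (Fin 3)),
          ‖x‖ ≤ ρ ∧ ContDiff ℝ 1 γ ∧ γ 0 = γ 1 ∧
          (∀ s ∈ Icc (0 : ℝ) 1, γ s ∈ Metric.closedBall x (1 / TowerRates.wide.N 1)) ∧
          (∀ s ∈ Icc (0 : ℝ) 1, ‖deriv γ s‖ ≤ 8 * Real.pi / TowerRates.wide.N 1) ∧
          TowerRates.wide.N 1 ^ (TowerRates.wide.β - 2) ≤ circulation (v Host.τfirst) γ)) :
    PalasekTowerBreakdown.EpisodeBase := by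
  obtain ⟨U, ρ, σ₀, ε, c₄, d, c, hc, g, h₁, h₂, hg, hwin, hsilent, hconf, v, q, hcl, h1, henergy, hceil,
    hfloor, hstrain, hcore⟩ := hex
  exact palasekTowerBreakdown_episodeBase_of_lineGerm_pushedRun d hc h₁ h₂ hg hwin hsilent hconf hcl h1
    henergy hceil hfloor hstrain hcore

end Summit.NavierStokesRegularity.NavierStokesRegularity.Theorems

end
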